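import Literature.Algebra.Homology.ExtOfAcyclicResolution
import HarnessLib

/-!
# Naturality of `Extⁿ(X, M) ≅ Hⁿ(Ext⁰(X, I•))` in the resolution

Topic `Algebra/Homology`; namespace `Literature.Algebra.Homology.AcyclicResolution`.  Sequel of
`ExtOfAcyclicResolution` (the isomorphisms `extAddEquivHomologyZero/Succ`), pure homological algebra,
no `sorry`, no named fact.

Given two exact, `Ext(X, –)`-acyclic augmented complexes `0 → M —η→ I•` and `0 → M' —η'→ I'•`, a
cochain map `φ : I ⟶ I'` and `g : M ⟶ M'` with `η ≫ φ⁰ = g ≫ η'`, the square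

  `Extⁿ(X, M)  ≃+  Hⁿ(Ext⁰(X, I•))`
  `  | g_*              | Hⁿ(φ_*)`
  `Extⁿ(X, M') ≃+  Hⁿ(Ext⁰(X, I'•))`

commutes (`extAddEquivHomologySucc_naturality`, `extAddEquivHomologyZero_naturality`).  This is the
"independence of the resolution / functoriality" half of the acyclic-resolution principle (Weibel
§2.4–2.7: comparison of resolutions; Hartshorne III 1.2A), and the input for every compatibility of
the comparison `Extⁿ_{C_Γ}(k, M) ≅ Hⁿ_cont(Γ, M)` (functoriality in `M`, change of group, products).
The proof follows the five steps of the construction: the cycle isomorphism `M ≅ Z⁰` (`liftCycles`),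
iterated dimension shifting (naturality of the classes of the short exact sequences
`0 → Zⁿ → Iⁿ → Zⁿ⁺¹ → 0`, Mathlib `ShortComplex.ShortExact.extClass_naturality`), the bottom quotient,
left exactness of `Hom`, and the concrete description of homology in `Ab`
(`ShortComplex.LeftHomologyMapData` for `abLeftHomologyData`).

## References
* C. A. Weibel, *An introduction to homological algebra*, CUP (1994), §2.4, Thm. 2.7.6 / Ex. 2.4.3. [Weibel1994]
-/

noncomputable section

universe w v u

namespace Literature.Algebra.Homology

namespace AcyclicResolution

open CategoryTheory CategoryTheory.Limits CategoryTheory.Abelian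

variable {C : Type u} [Category.{v} C] [Abelian C] [HasExt.{w} C]

/-- Unfolding of Mathlib's `Ext.postcomp`. [folklore] -/
private theorem postcomp_apply' (X : C) {Y Z : C} {n a b : ℕ} (β : Ext Y Z n) (h : a + n = b)
    (x : Ext X Y a) : β.postcomp X h x = x.comp β h := rfl

/-! ## §1 One step: naturality of the dimension shift -/

section OneStep

variable (X : C) {S₁ S₂ : ShortComplex C} (hS₁ : S₁.ShortExact) (hS₂ : S₂.ShortExact) (τ : S₁ ⟶ S₂)

/-- `shiftAddEquiv` commutes with a morphism of short exact sequences
(`extClass_naturality`). [cite: Weibel1994, §2.4 (dimension shifting, Exercise 2.4.3)] -/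
theorem shiftAddEquiv_naturality {a b : ℕ} (h : a + 1 = b)
    (ha₁ : ∀ e : Ext X S₁.X₂ a, e = 0) (hb₁ : ∀ e : Ext X S₁.X₂ b, e = 0)
    (ha₂ : ∀ e : Ext X S₂.X₂ a, e = 0) (hb₂ : ∀ e : Ext X S₂.X₂ b, e = 0) (x : Ext X S₁.X₃ a) :
    (shiftAddEquiv X hS₁ h ha₁ hb₁ x).comp (Ext.mk₀ τ.τ₁) (add_zero b) =
      shiftAddEquiv X hS₂ h ha₂ hb₂ (x.comp (Ext.mk₀ τ.τ₃) (add_zero a)) := by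
  rw [shiftAddEquiv_apply, shiftAddEquiv_apply, Ext.comp_assoc_of_third_deg_zero,
    ShortComplex.ShortExact.extClass_naturality hS₁ hS₂ τ, ← Ext.comp_assoc_of_second_deg_zero]

/-- `extOneQuotientAddEquiv` commutes with a morphism of short exact sequences: the class of
`δ y` goes to the class of `y ∘ τ₃`. [cite: Weibel1994, §2.4 (dimension shifting, Exercise 2.4.3)] -/
theorem extOneQuotientAddEquiv_naturality (h1₁ : ∀ e : Ext X S₁.X₂ 1, e = 0)
    (h1₂ : ∀ e : Ext X S₂.X₂ 1, e = 0) (x : Ext X S₁.X₁ 1) :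
    QuotientAddGroup.map _ _ ((Ext.mk₀ τ.τ₃).postcomp X (add_zero 0))
        (fun y hy => by
          obtain ⟨z, rfl⟩ := hy
          refine ⟨z.comp (Ext.mk₀ τ.τ₂) (add_zero 0), ?_⟩
          rw [postcomp_apply', postcomp_apply', postcomp_apply', Ext.comp_assoc_of_second_deg_zero,
            Ext.comp_assoc_of_second_deg_zero, Ext.mk₀_comp_mk₀, Ext.mk₀_comp_mk₀, τ.comm₂₃])
        (extOneQuotientAddEquiv X hS₁ h1₁ x) =
      extOneQuotientAddEquiv X hS₂ h1₂ (x.comp (Ext.mk₀ τ.τ₁) (add_zero 1)) := by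
  obtain ⟨y, rfl⟩ := extClass_postcomp_surjective X hS₁ (zero_add 1) h1₁ x
  have e₁ : extOneQuotientAddEquiv X hS₁ h1₁ (hS₁.extClass.postcomp X (zero_add 1) y) =
      QuotientAddGroup.mk y :=
    (AddEquiv.apply_eq_iff_symm_apply _).2 (extOneQuotientAddEquiv_symm_mk X hS₁ h1₁ y).symm
  have e₂ : (hS₁.extClass.postcomp X (zero_add 1) y).comp (Ext.mk₀ τ.τ₁) (add_zero 1) =
      hS₂.extClass.postcomp X (zero_add 1) (y.comp (Ext.mk₀ τ.τ₃) (add_zero 0)) := by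
    rw [postcomp_apply', postcomp_apply', Ext.comp_assoc_of_third_deg_zero,
      ShortComplex.ShortExact.extClass_naturality hS₁ hS₂ τ, ← Ext.comp_assoc_of_second_deg_zero]
  have e₃ : extOneQuotientAddEquiv X hS₂ h1₂
      (hS₂.extClass.postcomp X (zero_add 1) (y.comp (Ext.mk₀ τ.τ₃) (add_zero 0))) =
      QuotientAddGroup.mk (y.comp (Ext.mk₀ τ.τ₃) (add_zero 0)) :=
    (AddEquiv.apply_eq_iff_symm_apply _).2 (extOneQuotientAddEquiv_symm_mk X hS₂ h1₂ _).symm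
  rw [e₁, e₂, e₃]
  rfl

end OneStep

/-! ## §2 The cycle short exact sequences under a cochain map -/

section Cycles

variable (X : C) {I I' : CochainComplex C ℕ} (φ : I ⟶ I')

/-- The morphism `(0 → Zⁿ → Iⁿ → Zⁿ⁺¹ → 0) ⟶ (0 → Z'ⁿ → I'ⁿ → Z'ⁿ⁺¹ → 0)` induced by a cochain map.
[cite: Weibel1994, §2.4 (dimension shifting, Exercise 2.4.3)] -/
abbrev cyclesSCMap (n : ℕ) : cyclesSC I n ⟶ cyclesSC I' n where
  τ₁ := HomologicalComplex.cyclesMap φ n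
  τ₂ := φ.f n
  τ₃ := HomologicalComplex.cyclesMap φ (n + 1)
  comm₁₂ := HomologicalComplex.cyclesMap_i φ n
  comm₂₃ := by
    rw [← cancel_mono (I'.iCycles (n + 1)), Category.assoc, Category.assoc,
      HomologicalComplex.toCycles_i, HomologicalComplex.cyclesMap_i, HomologicalComplex.toCycles_i_assoc,
      φ.comm]

/-- Unfolding `iterShift` at `0`. [cite: Weibel1994, §2.4 (dimension shifting, Exercise 2.4.3)] -/
theorem iterShift_zero_apply (hI : ∀ n, I.ExactAt (n + 1))
    (hX : ∀ n q (e : Ext X (I.X n) (q + 1)), e = 0) {a : ℕ} (x : Ext X (I.cycles 0) (a + 1)) :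
    iterShift I X hI hX 0 (rfl : a + 1 + 0 = a + 1) x = x := rfl

/-- Unfolding `iterShift` at `n + 1`. [cite: Weibel1994, §2.4 (dimension shifting, Exercise 2.4.3)] -/
theorem iterShift_succ_apply (hI : ∀ n, I.ExactAt (n + 1))
    (hX : ∀ n q (e : Ext X (I.X n) (q + 1)), e = 0) (n : ℕ) {a b : ℕ} (h : a + 1 + (n + 1) = b)
    (x : Ext X (I.cycles (n + 1)) (a + 1)) :
    iterShift I X hI hX (n + 1) h x =
      iterShift I X hI hX n (a := a + 1) (by omega)
        (shiftAddEquiv X (cyclesSC_shortExact I n (hI n)) (rfl : a + 1 + 1 = a + 1 + 1) (hX n a)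
          (hX n (a + 1)) x) := rfl

/-- **Naturality of the iterated shift**: `iterShift` commutes with the maps induced by `φ` on the
cycles. [cite: Weibel1994, §2.4 (dimension shifting, Exercise 2.4.3)] -/
theorem iterShift_naturality (hI : ∀ n, I.ExactAt (n + 1)) (hX : ∀ n q (e : Ext X (I.X n) (q + 1)), e = 0)
    (hI' : ∀ n, I'.ExactAt (n + 1)) (hX' : ∀ n q (e : Ext X (I'.X n) (q + 1)), e = 0) :
    ∀ (n : ℕ) {a b : ℕ} (h : a + 1 + n = b) (x : Ext X (I.cycles n) (a + 1)),
      (iterShift I X hI hX n h x).comp (Ext.mk₀ (HomologicalComplex.cyclesMap φ 0)) (add_zero b) =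
        iterShift I' X hI' hX' n h (x.comp (Ext.mk₀ (HomologicalComplex.cyclesMap φ n)) (add_zero _))
  | 0, a, b, h, x => by
    subst h
    rw [iterShift_zero_apply, iterShift_zero_apply]
  | n + 1, a, b, h, x => by
    rw [iterShift_succ_apply, iterShift_succ_apply, iterShift_naturality hI hX hI' hX' n,
      shiftAddEquiv_naturality X (cyclesSC_shortExact I n (hI n)) (cyclesSC_shortExact I' n (hI' n))
        (cyclesSCMap φ n)]

/-- Naturality of `iterShift⁻¹`. [cite: Weibel1994, §2.4 (dimension shifting, Exercise 2.4.3)] -/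
theorem iterShift_symm_naturality (hI : ∀ n, I.ExactAt (n + 1))
    (hX : ∀ n q (e : Ext X (I.X n) (q + 1)), e = 0) (hI' : ∀ n, I'.ExactAt (n + 1))
    (hX' : ∀ n q (e : Ext X (I'.X n) (q + 1)), e = 0) (n : ℕ) {a b : ℕ} (h : a + 1 + n = b)
    (z : Ext X (I.cycles 0) b) :
    (iterShift I' X hI' hX' n h).symm (z.comp (Ext.mk₀ (HomologicalComplex.cyclesMap φ 0)) (add_zero b)) =
      ((iterShift I X hI hX n h).symm z).comp (Ext.mk₀ (HomologicalComplex.cyclesMap φ n)) (add_zero _) := by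
  apply (iterShift I' X hI' hX' n h).injective
  rw [AddEquiv.apply_symm_apply, ← iterShift_naturality X φ hI hX hI' hX' n h, AddEquiv.apply_symm_apply]

variable {M M' : C} (η : M ⟶ I.X 0) (hη : η ≫ I.d 0 1 = 0) (η' : M' ⟶ I'.X 0) (hη' : η' ≫ I'.d 0 1 = 0)
  (g : M ⟶ M') (hg : η ≫ φ.f 0 = g ≫ η')

omit [HasExt C] in
include hg in
/-- The cycle isomorphisms `M ≅ Z⁰`, `M' ≅ Z'⁰` are compatible with `g` and `φ`.
[cite: Weibel1994, §2.4 (dimension shifting, Exercise 2.4.3)] -/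
theorem isoCyclesZero_hom_naturality (hex : (ShortComplex.mk η (I.d 0 1) hη).Exact) [Mono η]
    (hex' : (ShortComplex.mk η' (I'.d 0 1) hη').Exact) [Mono η'] :
    (isoCyclesZero I η hη hex).hom ≫ HomologicalComplex.cyclesMap φ 0 =
      g ≫ (isoCyclesZero I' η' hη' hex').hom := by
  rw [← cancel_mono (I'.iCycles 0), Category.assoc, Category.assoc, HomologicalComplex.cyclesMap_i,
    isoCyclesZero_hom_iCycles, ← Category.assoc, isoCyclesZero_hom_iCycles, hg]

include hg in
/-- Naturality of the transport `extAddEquivOfIso` along `M ≅ Z⁰`.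
[cite: Weibel1994, §2.4 (dimension shifting, Exercise 2.4.3)] -/
theorem extAddEquivOfIso_isoCyclesZero_naturality (hex : (ShortComplex.mk η (I.d 0 1) hη).Exact)
    [Mono η] (hex' : (ShortComplex.mk η' (I'.d 0 1) hη').Exact) [Mono η'] (n : ℕ) (x : Ext X M n) :
    (extAddEquivOfIso X (isoCyclesZero I η hη hex) n x).comp
        (Ext.mk₀ (HomologicalComplex.cyclesMap φ 0)) (add_zero n) =
      extAddEquivOfIso X (isoCyclesZero I' η' hη' hex') n (x.comp (Ext.mk₀ g) (add_zero n)) := by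
  rw [extAddEquivOfIso_apply, extAddEquivOfIso_apply, Ext.comp_assoc_of_second_deg_zero,
    Ext.comp_assoc_of_second_deg_zero, Ext.mk₀_comp_mk₀, Ext.mk₀_comp_mk₀,
    isoCyclesZero_hom_naturality φ η hη η' hη' g hg]

end Cycles

/-! ## §3 The concrete homology side -/

section Concrete

variable (X : C) {I I' : CochainComplex C ℕ} (φ : I ⟶ I')

/-- The cochain map `Ext⁰(X, I•) ⟶ Ext⁰(X, I'•)` induced by `φ`. [cite: Weibel1994, §2.4 (dimension shifting, Exercise 2.4.3)] -/
abbrev extComplexMap : extComplex X I ⟶ extComplex X I' :=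
  ((extFunctorObj.{w} X 0).mapHomologicalComplex (ComplexShape.up ℕ)).map φ

/-- Componentwise formula. [cite: Weibel1994, §2.4 (dimension shifting, Exercise 2.4.3)] -/
@[simp]
theorem extComplexMap_f_apply (n : ℕ) (x : Ext X (I.X n) 0) :
    ((extComplexMap X φ).f n).hom x = x.comp (Ext.mk₀ (φ.f n)) (add_zero 0) := rfl

/-- `cyclesExtAddEquiv` commutes with `φ` (on underlying elements).
[cite: Weibel1994, §2.4 (dimension shifting, Exercise 2.4.3)] -/
theorem cyclesExtAddEquiv_naturality (i j k : ℕ) (hjk : (ComplexShape.up ℕ).next j = k)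
    (x : Ext X (I.cycles j) 0) :
    (cyclesExtAddEquiv X I' i j k hjk (x.comp (Ext.mk₀ (HomologicalComplex.cyclesMap φ j)) (add_zero 0))).1 =
      (cyclesExtAddEquiv X I i j k hjk x).1.comp (Ext.mk₀ (φ.f j)) (add_zero 0) := by
  rw [cyclesExtAddEquiv_apply_val, cyclesExtAddEquiv_apply_val, Ext.comp_assoc_of_second_deg_zero,
    Ext.comp_assoc_of_second_deg_zero, Ext.mk₀_comp_mk₀, Ext.mk₀_comp_mk₀,
    HomologicalComplex.cyclesMap_i]

/-- The morphism of windows `(extComplex X I).sc' i j k ⟶ (extComplex X I').sc' i j k` induced by `φ`.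
[cite: Weibel1994, §2.4 (dimension shifting, Exercise 2.4.3)] -/
abbrev sc'Map (i j k : ℕ) : (extComplex X I).sc' i j k ⟶ (extComplex X I').sc' i j k :=
  (HomologicalComplex.shortComplexFunctor' _ _ i j k).map (extComplexMap X φ)

/-- The map induced on `ker dʲ_*` (the `K` of `abLeftHomologyData`).
[cite: Weibel1994, §2.4 (dimension shifting, Exercise 2.4.3)] -/
def kerMap (i j k : ℕ) :
    AddMonoidHom.ker ((extComplex X I).sc' i j k).g.hom →+
      AddMonoidHom.ker ((extComplex X I').sc' i j k).g.hom :=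
  (((sc'Map X φ i j k).τ₂.hom).comp (AddMonoidHom.ker ((extComplex X I).sc' i j k).g.hom).subtype).codRestrict
    _ (fun y => by
      have hy : ((extComplex X I).sc' i j k).g.hom y.1 = 0 := y.2
      change ((sc'Map X φ i j k).τ₂ ≫ ((extComplex X I').sc' i j k).g).hom y.1 = 0
      rw [(sc'Map X φ i j k).comm₂₃]
      change ((sc'Map X φ i j k).τ₃).hom (((extComplex X I).sc' i j k).g.hom y.1) = 0
      rw [hy, map_zero])

/-- Formula for `kerMap` on underlying elements. [cite: Weibel1994, §2.4 (dimension shifting, Exercise 2.4.3)] -/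
@[simp]
theorem kerMap_apply_val (i j k : ℕ) (y : AddMonoidHom.ker ((extComplex X I).sc' i j k).g.hom) :
    (kerMap X φ i j k y).1 = (y.1 : Ext X (I.X j) 0).comp (Ext.mk₀ (φ.f j)) (add_zero 0) := rfl

/-- `kerMap` sends the image of `abToCycles` into the image of `abToCycles`.
[cite: Weibel1994, §2.4 (dimension shifting, Exercise 2.4.3)] -/
theorem range_abToCycles_le_comap_kerMap (i j k : ℕ) :
    ((extComplex X I).sc' i j k).abToCycles.range ≤
      (((extComplex X I').sc' i j k).abToCycles.range).comap (kerMap X φ i j k) := by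
  rintro _ ⟨x, rfl⟩
  refine ⟨((sc'Map X φ i j k).τ₁).hom x, Subtype.ext ?_⟩
  rw [ShortComplex.abToCycles_apply_coe, kerMap_apply_val, ShortComplex.abToCycles_apply_coe]
  change (((sc'Map X φ i j k).τ₁ ≫ ((extComplex X I').sc' i j k).f).hom x : Ext X (I'.X j) 0) = _
  rw [(sc'Map X φ i j k).comm₁₂]
  rfl

/-- The map induced on the concrete homology `ker dʲ_* ⧸ Im dⁱ_*`.
[cite: Weibel1994, §2.4 (dimension shifting, Exercise 2.4.3)] -/
def kerQuotMap (i j k : ℕ) :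
    AddMonoidHom.ker ((extComplex X I).sc' i j k).g.hom ⧸ ((extComplex X I).sc' i j k).abToCycles.range →+
      AddMonoidHom.ker ((extComplex X I').sc' i j k).g.hom ⧸ ((extComplex X I').sc' i j k).abToCycles.range :=
  QuotientAddGroup.map _ _ (kerMap X φ i j k) (range_abToCycles_le_comap_kerMap X φ i j k)

/-- The `LeftHomologyMapData` relating `abLeftHomologyData` of the two windows along `φ`.
[cite: Weibel1994, §2.4 (dimension shifting, Exercise 2.4.3)] -/
def abLeftHomologyMapData (i j k : ℕ) :
    ShortComplex.LeftHomologyMapData (sc'Map X φ i j k) ((extComplex X I).sc' i j k).abLeftHomologyData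
      ((extComplex X I').sc' i j k).abLeftHomologyData where
  φK := AddCommGrpCat.ofHom (kerMap X φ i j k)
  φH := AddCommGrpCat.ofHom (kerQuotMap X φ i j k)
  commi := rfl
  commf' := by
    ext x
    apply Subtype.ext
    change (kerMap X φ i j k (((extComplex X I).sc' i j k).abToCycles x)).1 =
      (((extComplex X I').sc' i j k).abToCycles (((sc'Map X φ i j k).τ₁).hom x)).1
    rw [kerMap_apply_val, ShortComplex.abToCycles_apply_coe, ShortComplex.abToCycles_apply_coe]
    change _ = (((sc'Map X φ i j k).τ₁ ≫ ((extComplex X I').sc' i j k).f).hom x : Ext X (I'.X j) 0)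
    rw [(sc'Map X φ i j k).comm₁₂]
    rfl
  commπ := rfl

/-- **Naturality of the concrete description of homology**: the homology map of `φ_*` corresponds,
under `homologyIsoSc' ≪≫ abHomologyIso`, to `kerQuotMap`. [cite: Weibel1994, §2.4 (dimension shifting, Exercise 2.4.3)] -/
theorem homologyMap_concrete (i j k : ℕ) (hi : (ComplexShape.up ℕ).prev j = i)
    (hk : (ComplexShape.up ℕ).next j = k) :
    HomologicalComplex.homologyMap (extComplexMap X φ) j ≫
        ((extComplex X I').homologyIsoSc' i j k hi hk ≪≫ ShortComplex.abHomologyIso _).hom =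
      ((extComplex X I).homologyIsoSc' i j k hi hk ≪≫ ShortComplex.abHomologyIso _).hom ≫
        AddCommGrpCat.ofHom (kerQuotMap X φ i j k) := by
  have h1 : HomologicalComplex.homologyMap (extComplexMap X φ) j ≫
      ((extComplex X I').homologyIsoSc' i j k hi hk).hom =
      ((extComplex X I).homologyIsoSc' i j k hi hk).hom ≫ ShortComplex.homologyMap (sc'Map X φ i j k) := by
    change ShortComplex.homologyMap ((HomologicalComplex.shortComplexFunctor _ _ j).map (extComplexMap X φ)) ≫
        ShortComplex.homologyMap ((HomologicalComplex.natIsoSc' _ _ i j k hi hk).hom.app (extComplex X I')) =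
      ShortComplex.homologyMap ((HomologicalComplex.natIsoSc' _ _ i j k hi hk).hom.app (extComplex X I)) ≫
        ShortComplex.homologyMap (sc'Map X φ i j k)
    rw [← ShortComplex.homologyMap_comp, ← ShortComplex.homologyMap_comp,
      (HomologicalComplex.natIsoSc' _ _ i j k hi hk).hom.naturality]
  rw [Iso.trans_hom, Iso.trans_hom, ← Category.assoc, h1, Category.assoc, Category.assoc]
  congr 1
  exact (abLeftHomologyMapData X φ i j k).homologyMap_comm

end Concrete

/-! ## §4 Naturality of the main isomorphisms -/

section Main

variable (X : C) {I I' : CochainComplex C ℕ} (φ : I ⟶ I')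
  {M M' : C} (η : M ⟶ I.X 0) (hη : η ≫ I.d 0 1 = 0) (hex : (ShortComplex.mk η (I.d 0 1) hη).Exact)
  (η' : M' ⟶ I'.X 0) (hη' : η' ≫ I'.d 0 1 = 0) (hex' : (ShortComplex.mk η' (I'.d 0 1) hη').Exact)
  (g : M ⟶ M') (hg : η ≫ φ.f 0 = g ≫ η')
  (hI : ∀ n, I.ExactAt (n + 1)) (hX : ∀ n q (e : Ext X (I.X n) (q + 1)), e = 0)
  (hI' : ∀ n, I'.ExactAt (n + 1)) (hX' : ∀ n q (e : Ext X (I'.X n) (q + 1)), e = 0)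

include hg in
/-- **Naturality of `extAddEquivHomologySucc`**: for a morphism of exact `Ext(X, –)`-acyclic
augmented complexes `(g, φ)`, the isomorphisms `Extⁿ⁺¹(X, M) ≃+ Hⁿ⁺¹(Ext⁰(X, I•))` intertwine
`g_*` with `Hⁿ⁺¹(φ_*)`. [cite: Weibel1994, §2.4 (dimension shifting, Exercise 2.4.3)] -/
theorem extAddEquivHomologySucc_naturality [Mono η] [Mono η'] (n : ℕ) (x : Ext X M (n + 1)) :
    (HomologicalComplex.homologyMap (extComplexMap X φ) (n + 1)).hom
        (extAddEquivHomologySucc X I η hη hex hI hX n x) =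
      extAddEquivHomologySucc X I' η' hη' hex' hI' hX' n (x.comp (Ext.mk₀ g) (add_zero _)) := by
  -- abbreviations for the concrete isomorphisms `H ≅ ker/Im`
  set e5 := ((extComplex X I).homologyIsoSc' n (n + 1) (n + 1 + 1) (CochainComplex.prev_nat_succ n)
      (CochainComplex.next ℕ (n + 1)) ≪≫ ShortComplex.abHomologyIso _) with he5
  set e5' := ((extComplex X I').homologyIsoSc' n (n + 1) (n + 1 + 1) (CochainComplex.prev_nat_succ n)
      (CochainComplex.next ℕ (n + 1)) ≪≫ ShortComplex.abHomologyIso _) with he5'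
  -- it suffices to check after applying `e5'`
  apply e5'.addCommGroupIsoToAddEquiv.injective
  have hnat := homologyMap_concrete X φ n (n + 1) (n + 1 + 1) (CochainComplex.prev_nat_succ n)
    (CochainComplex.next ℕ (n + 1))
  have step5 : e5'.addCommGroupIsoToAddEquiv ((HomologicalComplex.homologyMap (extComplexMap X φ)
      (n + 1)).hom (extAddEquivHomologySucc X I η hη hex hI hX n x)) =
      kerQuotMap X φ n (n + 1) (n + 1 + 1) (e5.addCommGroupIsoToAddEquiv
        (extAddEquivHomologySucc X I η hη hex hI hX n x)) := by
    change (HomologicalComplex.homologyMap (extComplexMap X φ) (n + 1) ≫ e5'.hom).hom _ =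
      (e5.hom ≫ AddCommGrpCat.ofHom (kerQuotMap X φ n (n + 1) (n + 1 + 1))).hom _
    rw [hnat]
  rw [step5]
  -- unfold the definition of `extAddEquivHomologySucc` on both sides
  change kerQuotMap X φ n (n + 1) (n + 1 + 1) (e5.addCommGroupIsoToAddEquiv (e5.addCommGroupIsoToAddEquiv.symm
      (QuotientAddGroup.congr _ _ (cyclesExtAddEquiv X I n (n + 1) (n + 1 + 1) (CochainComplex.next ℕ (n + 1)))
        (map_cyclesExtAddEquiv_range X I n)
        (extOneQuotientAddEquiv X (cyclesSC_shortExact I n (hI n)) (hX n 0)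
          ((iterShift I X hI hX n (a := 0) (b := n + 1) (by omega)).symm
            (extAddEquivOfIso X (isoCyclesZero I η hη hex) (n + 1) x)))))) =
    e5'.addCommGroupIsoToAddEquiv (e5'.addCommGroupIsoToAddEquiv.symm
      (QuotientAddGroup.congr _ _ (cyclesExtAddEquiv X I' n (n + 1) (n + 1 + 1) (CochainComplex.next ℕ (n + 1)))
        (map_cyclesExtAddEquiv_range X I' n)
        (extOneQuotientAddEquiv X (cyclesSC_shortExact I' n (hI' n)) (hX' n 0)
          ((iterShift I' X hI' hX' n (a := 0) (b := n + 1) (by omega)).symm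
            (extAddEquivOfIso X (isoCyclesZero I' η' hη' hex') (n + 1) (x.comp (Ext.mk₀ g) (add_zero _)))))))
  rw [AddEquiv.apply_symm_apply, AddEquiv.apply_symm_apply]
  -- step 1 + 2: push `g` through the cycle iso and the iterated shift
  have step12 : (iterShift I' X hI' hX' n (a := 0) (b := n + 1) (by omega)).symm
      (extAddEquivOfIso X (isoCyclesZero I' η' hη' hex') (n + 1) (x.comp (Ext.mk₀ g) (add_zero _))) =
      ((iterShift I X hI hX n (a := 0) (b := n + 1) (by omega)).symm
        (extAddEquivOfIso X (isoCyclesZero I η hη hex) (n + 1) x)).comp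
          (Ext.mk₀ (HomologicalComplex.cyclesMap φ n)) (add_zero _) := by
    rw [← extAddEquivOfIso_isoCyclesZero_naturality X φ η hη η' hη' g hg hex hex',
      iterShift_symm_naturality X φ hI hX hI' hX']
  rw [step12]
  -- step 3: the bottom quotient
  set y := (iterShift I X hI hX n (a := 0) (b := n + 1) (by omega)).symm
    (extAddEquivOfIso X (isoCyclesZero I η hη hex) (n + 1) x) with hy
  have step3 := extOneQuotientAddEquiv_naturality X (cyclesSC_shortExact I n (hI n))
    (cyclesSC_shortExact I' n (hI' n)) (cyclesSCMap φ n) (hX n 0) (hX' n 0) y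
  change _ = QuotientAddGroup.congr _ _ _ (map_cyclesExtAddEquiv_range X I' n)
    (extOneQuotientAddEquiv X (cyclesSC_shortExact I' n (hI' n)) (hX' n 0)
      (y.comp (Ext.mk₀ (cyclesSCMap φ n).τ₁) (add_zero 1)))
  rw [← step3]
  -- step 4: the two quotient maps agree on representatives
  obtain ⟨z, hz⟩ := QuotientAddGroup.mk_surjective
    (extOneQuotientAddEquiv X (cyclesSC_shortExact I n (hI n)) (hX n 0) y)
  rw [← hz]
  change QuotientAddGroup.mk (kerMap X φ n (n + 1) (n + 1 + 1)
      (cyclesExtAddEquiv X I n (n + 1) (n + 1 + 1) (CochainComplex.next ℕ (n + 1)) z)) =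
    QuotientAddGroup.mk (cyclesExtAddEquiv X I' n (n + 1) (n + 1 + 1) (CochainComplex.next ℕ (n + 1))
      ((Ext.mk₀ (cyclesSCMap φ n).τ₃).postcomp X (add_zero 0) z))
  congr 1
  apply Subtype.ext
  rw [kerMap_apply_val, postcomp_apply']
  exact (cyclesExtAddEquiv_naturality X φ n (n + 1) (n + 1 + 1) (CochainComplex.next ℕ (n + 1)) z).symm

include hg in
/-- **Naturality of `extAddEquivHomologyZero`.** [cite: Weibel1994, §2.4 (dimension shifting, Exercise 2.4.3)] -/
theorem extAddEquivHomologyZero_naturality [Mono η] [Mono η'] (x : Ext X M 0) :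
    (HomologicalComplex.homologyMap (extComplexMap X φ) 0).hom
        (extAddEquivHomologyZero X I η hη hex x) =
      extAddEquivHomologyZero X I' η' hη' hex' (x.comp (Ext.mk₀ g) (add_zero _)) := by
  set e5 := ((extComplex X I).homologyIsoSc' 0 0 1 CochainComplex.prev_nat_zero
      (CochainComplex.next ℕ 0) ≪≫ ShortComplex.abHomologyIso _) with he5
  set e5' := ((extComplex X I').homologyIsoSc' 0 0 1 CochainComplex.prev_nat_zero
      (CochainComplex.next ℕ 0) ≪≫ ShortComplex.abHomologyIso _) with he5'
  apply e5'.addCommGroupIsoToAddEquiv.injective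
  have hnat := homologyMap_concrete X φ 0 0 1 CochainComplex.prev_nat_zero (CochainComplex.next ℕ 0)
  have step5 : e5'.addCommGroupIsoToAddEquiv ((HomologicalComplex.homologyMap (extComplexMap X φ) 0).hom
      (extAddEquivHomologyZero X I η hη hex x)) =
      kerQuotMap X φ 0 0 1 (e5.addCommGroupIsoToAddEquiv (extAddEquivHomologyZero X I η hη hex x)) := by
    change (HomologicalComplex.homologyMap (extComplexMap X φ) 0 ≫ e5'.hom).hom _ =
      (e5.hom ≫ AddCommGrpCat.ofHom (kerQuotMap X φ 0 0 1)).hom _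
    rw [hnat]
  rw [step5]
  change kerQuotMap X φ 0 0 1 (e5.addCommGroupIsoToAddEquiv (e5.addCommGroupIsoToAddEquiv.symm
      (QuotientAddGroup.quotientAddEquivOfEq (abToCycles_zero_range_eq_bot X I).symm
        (QuotientAddGroup.quotientBot.symm
          (cyclesExtAddEquiv X I 0 0 1 (CochainComplex.next ℕ 0)
            (extAddEquivOfIso X (isoCyclesZero I η hη hex) 0 x)))))) =
    e5'.addCommGroupIsoToAddEquiv (e5'.addCommGroupIsoToAddEquiv.symm
      (QuotientAddGroup.quotientAddEquivOfEq (abToCycles_zero_range_eq_bot X I').symm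
        (QuotientAddGroup.quotientBot.symm
          (cyclesExtAddEquiv X I' 0 0 1 (CochainComplex.next ℕ 0)
            (extAddEquivOfIso X (isoCyclesZero I' η' hη' hex') 0 (x.comp (Ext.mk₀ g) (add_zero _)))))))
  rw [AddEquiv.apply_symm_apply, AddEquiv.apply_symm_apply,
    ← extAddEquivOfIso_isoCyclesZero_naturality X φ η hη η' hη' g hg hex hex']
  change QuotientAddGroup.mk (kerMap X φ 0 0 1 (cyclesExtAddEquiv X I 0 0 1 (CochainComplex.next ℕ 0)
      (extAddEquivOfIso X (isoCyclesZero I η hη hex) 0 x))) =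
    QuotientAddGroup.mk (cyclesExtAddEquiv X I' 0 0 1 (CochainComplex.next ℕ 0)
      ((extAddEquivOfIso X (isoCyclesZero I η hη hex) 0 x).comp
        (Ext.mk₀ (HomologicalComplex.cyclesMap φ 0)) (add_zero 0)))
  congr 1
  apply Subtype.ext
  rw [kerMap_apply_val]
  exact (cyclesExtAddEquiv_naturality X φ 0 0 1 (CochainComplex.next ℕ 0) _).symm

end Main

end AcyclicResolution

end Literature.Algebra.Homology
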